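import Summits.QuantumFields.YangMills.Theorems.BalabanUVNodesN10AtRecord11B13Family
import Summits.QuantumFields.YangMills.Theorems.BalabanUVNodesN10AtRecord12B13

/-!
# BalabanUVNodes ∕ N10 IN THE HISTORY-INDEXED FAMILY CURRENCY AT STAGE 12, AT def-B13's LETTERS OF RECORD — [Balaban1988RG2Cluster] Lemmas 1–2 knit MEMBER-WISE
# from their located inputs over a Stage-12 family `lamF : Node00.ResidB13Fam₁₂ F N θ` at a run, Lemma 3 the member-wise located FLAG (resp. at LEVEL T), with
# `δ < 1` and `g_k ≠ 0` DISCHARGED at the record ⟹ THE FAMILY LEAF OF RECORD `Node00.B13FamLeafOfRecord₁₂ F N θ c lamF P` (= N09's (iv⁵) `hfam` currency, N26's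
# in-edge); the DAG pin at a box member; the K1′-facing ∃-face (Track A, DAG node N10 [B13]; strategy s2; seat `pub-ymgap-dag-n10-d` g4; companion of
# `…N10AtRecord11B13Family` (Stage 3′) at def-B13's `Node00/Record12CarriersB13Family` p476387)

HONEST FRAMING.  Count-neutral kernel bookkeeping over LANDED modules: NODE 00's `Record12CarriersB13Family` (def-B13 g3: `ResidB13Fam₁₂`, the LETTERS OF RECORD
`c13OfRecord₁₂ θ c = {c with L := ℓ₆+1, δ := (1 − 2∕L)∕10, γ := θ.γ, E₀ := θ.s2.lf.E₀, κ := θ.s2.lf.κ}` with `c13OfRecord₁₂_delta_lt_one` and `c13OfRecord₁₂_R22`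
PROVED, `B13FamLeafOfRecord₁₂`, the member bridge `b13LeafOfRecord_member₁₂`, `hfam_of_b13FamLeafOfRecord₁₂`), this seat's Stage-3′ family junction
`…N10AtRecord11B13Family` (`b13FamLeafOfRecord_of_located(_termwise)`) and Stage-12 pin module `…N10AtRecord12B13` (p468258: `b13_main_at_pinB13₁₂_of_leafOfRecord`,
`exists_record₁₂C_pinB13World_b13_main_of_leafOfRecord`).  §1 is the Stage-3′ junction READ AT THE LETTERS OF RECORD: box = the coupling window OF RECORD `θ.γ`,
the ONE constants record = `c13OfRecord₁₂ θ c` (ONE residual `c` for ALL runs), the member letters law `(lamF P k v).c = c13OfRecord₁₂ θ c` (def-B13's displayed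
conjunct, n26-c's `hcF`), the index law `IsStepIndexed θ.γ (lamF P)`; TWO located inputs are DISCHARGED BY NAME at the record — Lemma 1's `δ < 1`
(`c13OfRecord₁₂_delta_lt_one`) and Lemma 2's `g_k ≠ 0` (`IsStepIndexed.g_ne_zero`: `0 < g_k` in the box) — and the thresholds are READ IN θ's OWN LETTERS.
LOCATED REMARK (a reading, not a defect): at the letters of record the k-uniform thresholds of Lemma 1 constrain θ's (I.1.18) decay rate `θ.s2.lf.κ` (`0 ≤ κ`,
`kappa₀ 64 8 ≤ κ`, `1 ≤ δκ`, `kappa₀ 64 8 ≤ δκ`, R8∕R9 against the residual `κ₁`) and (I.1.18)'s `θ.s2.lf.E₀` (the choice `hC` of C₁, C₂, q) — UNCONSTRAINED numerics of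
`Stage12Params` (`Admissible` carries no κ ∕ E₀ clause), so the Stage-12 junction speaks about packages whose (I.1.18) rate is large, as print assumes («κ sufficiently
large», [I] p. 263; [II] p. 21 «δ₀M ≥ κ»); IN NUMBERS (§3, kernel): `hκ126` needs `κ ≥ 64·log 162 ≈ 325.6`, `hκ126'` needs `κ ≥ 640·log 162 ≈ 3256`, `hδκ` needs
`κ > 10` — so AT NODE 00's displayed default letters (`Record12Numerics.lfConstsOfRecord₁₂`, `κ := 1`, carried by K0′'s witness θ₀ by `rfl`) §1 is VACUOUS
(`not_threshold_δκ_of_kappa_le_ten`, `not_threshold126_of_kappa_eq_one`): N10's side of dag-lead's FLAG-K0′-KAPPA (DEDUP-227; n26-c g4 LOCATED-N26-KAPPA: (D4)'s `CondsL`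
needs `128·log 162`) — a located numeric demand on the witness, NOT a refutation (print's κ IS large); §1 is never stated «at θ₀»; cure = the K0′ lineage's re-pinned κ.
The RESIDUAL letters `κ₁, δ₀, M, q, ε₁, C₁, C₂, C₃, γ₂, α…` stay the prover's (def-B13's census §2).  N10 is NOT discharged:
every located per-term input is a HYPOTHESIS about the HIDDEN family, NODE A's content (the FLAG ∕ (2.26) per term) is displayed, and in the ∃-currency over `lamF`
the family leaf of record is junk through THE TERMS (def-B13's `exists_residB13Fam₁₂_forall_b13FamLeafOfRecord₁₂`: at `ε₁ = 0` the constant ZERO family passes at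
EVERY Stage-12 package — cited, not re-derived; content = the term tower OF RECORD, XL, absent, or THIS ∀-lawful ∕ termwise currency).  K0′ is NOT asserted.
Nothing of Bałaban's is asserted; no node count moves; one finite four-torus programme at fixed ε per run; nothing continuum ∕ ℝ⁴ ∕ OS ∕ mass-gap ∕ Clay.
0 `sorry`, 0 `def`, standard axioms.  Filed `--supports` K1′ «StabilityBAtRecordR12e» (stmt-QuantumFields-19903) of route «BalabanUVNodes».

CONSUMERS BY NAME.  N09's (iv⁵) `B12NodeKnit.b12_main_of_up_frameOf_of_b13Family_eHolo` at `S13 := S13FamOfRecord₁₂ θ lamF P`, `c13 := c13OfRecord₁₂ θ c`,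
`γ13 := θ.γ`: `hfam := hfam_of_b13FamLeafOfRecord₁₂ (b13FamLeafOfRecord₁₂_of_located …)`, `h22 := c13OfRecord₁₂_R22` (def-B13); dag-n26-c g4's
`…N26AtRecord12B13Family` (`hleafF := fun P => b13FamLeafOfRecord₁₂_of_located … P …`, `hcF` = the letters law); n24-c's `stub_nodes12` socket at the
[B13]-pinned world via §2.

WHAT THIS FILE PROVES.  §1 `b13FamLeafOfRecord₁₂_of_located` (Lemmas 1–2 member-wise from located inputs, Lemma 3 the member-wise FLAG, `δ < 1` ∕ `g ≠ 0`
discharged ⟹ `B13FamLeafOfRecord₁₂ F N θ c lamF P`), `b13FamLeafOfRecord₁₂_of_located_termwise` (LEVEL T: (2.26) per term per member at the natural rate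
`γ₂ε₁²∕g_k²`, ONE `Lemma3Numerics` bundle at the window-minimal rate `γ₂ε₁²∕γ²` — print p. 18 literally —, the fineness law, `8 ≤ L`); §2
`b13_main_at_pinB13₁₂_of_famLeafOfRecord` (the DAG pin at a box member), `exists_record₁₂C_pinB13World_b13_main_of_famLeafOfRecord` (K1′-facing ∃-face); §3 the located
κ-demand in numbers (`kappa₀_64_8`, `kappa_ge_of_threshold126(')`, `not_threshold_δκ_of_kappa_le_ten`, `not_threshold126_of_kappa_eq_one`); §3b (v1.1, append-only)
the SUFFICIENT side `thresholds_of_kappa_ge` (κ ≥ 2·10⁴, κ₁ ≥ 16κ + 1 ⇒ every rate threshold of §1 at the record's δ, all L ≥ 3; `one_div_thirty_le_delta`, `kappa₀_64_8_le_384`).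
-/

noncomputable section

namespace Summit.QuantumFields.YangMills.BalabanUVNodes.N10AtRecord12B13Family

open Literature.MathematicalPhysics.QuantumFieldTheory.Balaban1983to89
open Literature.MathematicalPhysics.QuantumFieldTheory.Balaban1983to89.T4Continuum
open Literature.MathematicalPhysics.QuantumFieldTheory.Balaban1983to89.DagBinding
open Literature.MathematicalPhysics.QuantumFieldTheory.Balaban1983to89.Node00
open Literature.MathematicalPhysics.QuantumFieldTheory.Balaban1983to89.B13Lemma3Torus (TwoTorusStep)
open Literature.MathematicalPhysics.QuantumFieldTheory.Balaban1983to89.B13Lemma3TorusSocket (TermDomination Termwise226 Lemma3Numerics)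
open Metric
open Literature.MathematicalPhysics.QuantumFieldTheory.Balaban1983to89.B16Absorption (pbox)
open Literature.MathematicalPhysics.QuantumFieldTheory.Balaban1983to89.TreeLengthTorus
open Literature.MathematicalPhysics.QuantumFieldTheory.Balaban1983to89.TreeLengthTorusTransfer (tcoarse)
open Literature.MathematicalPhysics.QuantumFieldTheory.Balaban1983to89.B12TreeDecay (kappa₀ K₀ a₀)
open Literature.MathematicalPhysics.QuantumFieldTheory.Balaban1983to89.B13PkScaling (Qop scaled)
open Summit.QuantumFields.YangMills.BalabanUVNodes.N10AtRecord11B13Family (b13FamLeafOfRecord_of_located b13FamLeafOfRecord_of_located_termwise)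
open Summit.QuantumFields.YangMills.BalabanUVNodes.N10AtRecord12B13 (b13_main_at_pinB13₁₂_of_leafOfRecord exists_record₁₂C_pinB13World_b13_main_of_leafOfRecord)

/-! ## §1. THE JUNCTION IN THE FAMILY CURRENCY AT STAGE 12, AT THE LETTERS OF RECORD -/

section Letters12

variable (F : T4Family) (N : ℕ) [NeZero N]
variable (θ : Stage12Params F N) (c : B13.Consts) (lamF : ResidB13Fam₁₂ F N θ) (P : B12.RunParams)

set_option maxSynthPendingDepth 3 in
/-- **THE [B13] FAMILY LEAF OF RECORD AT A STAGE-12 RUN — LEMMAS 1–2 KNIT MEMBER-WISE FROM THEIR LOCATED PER-TERM INPUTS AT THE LETTERS OF RECORD, LEMMA 3 THE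
MEMBER-WISE LOCATED FLAG; `δ < 1` AND `g_k ≠ 0` DISCHARGED.**  At a Stage-12 package `θ`, a residual letter record `c`, a Stage-12 family `lamF` and a run `P`: IF on
the window-of-record box `]0, θ.γ]^{k+1}` every member's letter field IS the letters of record (`hc`, def-B13's displayed conjunct) and the family carries the index law
(`hidx`), and every member in the box satisfies print's located input of LEMMA 1 (pp. 7–9) and LEMMA 2 (pp. 10–11) — `…N10AtRecord11B13Family.b13FamLeafOfRecord_of_located`'s
list READ AT `c₀ := c13OfRecord₁₂ θ c`: the thresholds on (I.1.18)'s rate are on θ's OWN letter `θ.s2.lf.κ` and the record's `δ = (1 − 2∕L)∕10`, the choice `hC` of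
C₁, C₂, q reads θ's `E₀ = θ.s2.lf.E₀`, the residual letters `κ₁, δ₀, M, q, ε₁, C₁, C₂, C₃` are `c`'s; `δ < 1` is the THEOREM `c13OfRecord₁₂_delta_lt_one` and `g_k ≠ 0`
is `IsStepIndexed.g_ne_zero` (both DISCHARGED, absent from the list) — and LEMMA 3 (p. 20) holds member-wise as THE FLAG `h3` (NODE A's content, displayed), THEN
**`B13FamLeafOfRecord₁₂ F N θ c lamF P`** — the family leaf of record the consumers read (N09's (iv⁵) `hfam` via `hfam_of_b13FamLeafOfRecord₁₂`, `h22` :=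
`c13OfRecord₁₂_R22`; N26's `hleafF`).  Count-neutral: hypotheses about the HIDDEN family; nothing of Bałaban's is asserted.
[cite: Balaban1988RG2Cluster, Lemma 1 p.9, Lemma 2 p.11, Lemma 3 p.20, p.21 (after (2.41): δ, ½E₀, (I.1.18)); Balaban1987RG1, Thm 3 p.264, (1.18) p.263] -/
theorem b13FamLeafOfRecord₁₂_of_located
    (hc : ∀ k v, v ∈ FlowStep.Box θ.γ k → (lamF P k v).c = c13OfRecord₁₂ F N θ c) (hidx : ResidB13Fam.IsStepIndexed θ.γ (lamF P))
    (hN12 : ∀ k v, v ∈ FlowStep.Box θ.γ k → 12 ≤ (θ.ℓ₆ + 1) * ((lamF P k v).n + 1))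
    -- (1) LEMMA 1: [I]'s block geometry of the (1.33) index families of every member in the box
    (dist : (k : ℕ) → (v : Fin (k + 1) → ℝ) → TDom 4 ((θ.ℓ₆ + 1) * ((lamF P k v).n + 1)) → TPt 4 ((θ.ℓ₆ + 1) * ((lamF P k v).n + 1)) → (j : ℕ) →
      TPt 4 ((θ.ℓ₆ + 1) ^ ((lamF P k v).k - j) * ((θ.ℓ₆ + 1) * ((lamF P k v).n + 1))) → ℝ) {K K' : ℝ}
    (hS0Y : ∀ k v, v ∈ FlowStep.Box θ.γ k → ∀ Y, ∀ a ∈ (lamF P k v).S0 Y,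
      (pbox (fun i => natLift a i - (5 : ℕ)) (fun i => natLift a i + 1 + (5 : ℕ))).image (proj ((θ.ℓ₆ + 1) * ((lamF P k v).n + 1))) ⊆ Y.1)
    (hFsub : ∀ k v, v ∈ FlowStep.Box θ.γ k → ∀ Y a, (lamF P k v).F Y a ⊆
      (pbox (fun i => natLift a i - (5 : ℕ)) (fun i => natLift a i + 1 + (5 : ℕ))).image (proj ((θ.ℓ₆ + 1) * ((lamF P k v).n + 1))) \
        (pbox (fun i => natLift a i - (4 : ℕ)) (fun i => natLift a i + 1 + (4 : ℕ))).image (proj ((θ.ℓ₆ + 1) * ((lamF P k v).n + 1))))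
    (hSq : ∀ k v, v ∈ FlowStep.Box θ.γ k → ∀ Y, ∀ a ∈ (lamF P k v).S0 Y, ∀ j, (lamF P k v).Sq Y a j ⊆
      (Finset.univ : Finset (TPt 4 ((θ.ℓ₆ + 1) ^ ((lamF P k v).k - j) * ((θ.ℓ₆ + 1) * ((lamF P k v).n + 1))))).filter
        (fun q => tcoarse ((θ.ℓ₆ + 1) ^ ((lamF P k v).k - j)) ((θ.ℓ₆ + 1) * ((lamF P k v).n + 1)) q ∈
          (pbox (fun i => natLift a i - (2 : ℕ)) (fun i => natLift a i + 1 + (2 : ℕ))).image (proj ((θ.ℓ₆ + 1) * ((lamF P k v).n + 1)))))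
    (hScY : ∀ k v, v ∈ FlowStep.Box θ.γ k → ∀ Y, (lamF P k v).Sc Y ⊆ Y.1)
    (hdist0 : ∀ k v, v ∈ FlowStep.Box θ.γ k → ∀ Y a j q, 0 ≤ c.δ₀ * dist k v Y a j q)
    (hdist : ∀ k v, v ∈ FlowStep.Box θ.γ k → ∀ Y a j (n : ℕ) q,
      q ∉ (pbox (fun i => (((θ.ℓ₆ + 1) ^ ((lamF P k v).k - j) : ℕ) : ℤ) * natLift a i - (n + 1 : ℕ))
        (fun i => (((θ.ℓ₆ + 1) ^ ((lamF P k v).k - j) : ℕ) : ℤ) * natLift a i + 2 * (((θ.ℓ₆ + 1) ^ ((lamF P k v).k - j) : ℕ) : ℤ) - 1 + (n + 1 : ℕ))).image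
          (proj ((θ.ℓ₆ + 1) ^ ((lamF P k v).k - j) * ((θ.ℓ₆ + 1) * ((lamF P k v).n + 1)))) →
        c.δ₀ * c.M * ((n : ℝ) + 1) ≤ c.δ₀ * dist k v Y a j q)
    (hSX : ∀ k v, v ∈ FlowStep.Box θ.γ k → ∀ Y a j q,
      (lamF P k v).SX Y a j q ⊆ (tcubeSys 4 ((θ.ℓ₆ + 1) ^ ((lamF P k v).k - j) * ((θ.ℓ₆ + 1) * ((lamF P k v).n + 1)))).above q)
    (hSX' : ∀ k v, v ∈ FlowStep.Box θ.γ k → ∀ Y a j q,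
      (lamF P k v).SX' Y a j q ⊆ (tcubeSys 4 ((θ.ℓ₆ + 1) ^ ((lamF P k v).k - j) * ((θ.ℓ₆ + 1) * ((lamF P k v).n + 1)))).above q)
    (hX0 : ∀ k v, v ∈ FlowStep.Box θ.γ k → ∀ Y, ∀ a ∈ (lamF P k v).Sc Y, ∀ j ∈ Finset.range ((lamF P k v).k + 1), ∀ q ∈ (lamF P k v).Sq' Y a j,
      ∀ x ∈ (lamF P k v).SX' Y a j q, x.1.image (tcoarse ((θ.ℓ₆ + 1) ^ ((lamF P k v).k - j)) ((θ.ℓ₆ + 1) * ((lamF P k v).n + 1))) ⊆ Y.1)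
    -- (1) LEMMA 1: per-term analyticity on (1.34), every member in the box
    (hAnT : ∀ k v, v ∈ FlowStep.Box θ.γ k → ∀ Y, ∀ a ∈ (lamF P k v).S0 Y, ∀ X ∈ ((lamF P k v).F Y a).powerset, ∀ j ∈ Finset.range ((lamF P k v).k + 1),
      ∀ q ∈ (lamF P k v).Sq Y a j, ∀ x ∈ (lamF P k v).SX Y a j q, AnalyticOnNhd ℂ ((lamF P k v).T Y a X j q x) ((lamF P k v).sp1 Y))
    (hAnT' : ∀ k v, v ∈ FlowStep.Box θ.γ k → ∀ Y, ∀ a ∈ (lamF P k v).Sc Y, ∀ j ∈ Finset.range ((lamF P k v).k + 1), ∀ q ∈ (lamF P k v).Sq' Y a j,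
      ∀ x ∈ (lamF P k v).SX' Y a j q, AnalyticOnNhd ℂ ((lamF P k v).T' Y a j q x) ((lamF P k v).sp1 Y))
    -- (1) LEMMA 1: the k-UNIFORM thresholds READ IN θ's OWN LETTERS (κ, δ of record) and the residual letters (κ₁, δ₀, M); `δ < 1` DISCHARGED (`c13OfRecord₁₂_delta_lt_one`)
    (hK : 0 ≤ K) (hK' : 0 ≤ K') (hκ : 0 ≤ θ.s2.lf.κ) (hδκ : 1 ≤ (c13OfRecord₁₂ F N θ c).δ * θ.s2.lf.κ)
    (hκ126 : kappa₀ 64 8 ≤ θ.s2.lf.κ) (hκ126' : kappa₀ 64 8 ≤ (c13OfRecord₁₂ F N θ c).δ * θ.s2.lf.κ)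
    (hκ₁ : 1 + 2 * Real.log (8 * 12 ^ 3) ≤ c.κ₁) (hκ₁' : 2 + 16 * Real.log 128 ≤ c.κ₁)
    (hδ₀M : 10 * Real.exp (-1) ≤ c.δ₀ * c.M) (hδ₀M5 : 2 * Real.log 5 ≤ c.δ₀ * c.M)
    (hR8 : (1 - (c13OfRecord₁₂ F N θ c).δ) * θ.s2.lf.κ ≤ (1 / 4) * (c.κ₁ - 1)) (hR9 : (1 - 2 * (c13OfRecord₁₂ F N θ c).δ) * θ.s2.lf.κ ≤ (1 / 16) * c.κ₁)
    -- (1) LEMMA 1: per-term (1.24), (1.30) by reference to [I] (3.54), (3.17), [15] Prop. 4, [13] (3.108), every member in the box; k-UNIFORM `K, K′`; the choice `hC` reads θ's `E₀`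
    (h124 : ∀ k v, v ∈ FlowStep.Box θ.γ k → ∀ Y φ, φ ∈ (lamF P k v).sp1 Y → ∀ a ∈ (lamF P k v).S0 Y, ∀ X ∈ ((lamF P k v).F Y a).powerset,
      ∀ j ∈ Finset.range ((lamF P k v).k + 1), ∀ q ∈ (lamF P k v).Sq Y a j, ∀ x ∈ (lamF P k v).SX Y a j q,
        ‖(lamF P k v).T Y a X j q x φ‖ ≤ K * (((θ.ℓ₆ + 1 : ℕ) : ℝ) ^ j * (((θ.ℓ₆ + 1 : ℕ) : ℝ) ^ (lamF P k v).k)⁻¹) ^ 5 *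
          Real.exp (-(c.κ₁ - 1) *
            (((Y.1 \ (pbox (fun i => natLift a i - (5 : ℕ)) (fun i => natLift a i + 1 + (5 : ℕ))).image
              (proj ((θ.ℓ₆ + 1) * ((lamF P k v).n + 1)))).card : ℝ) + X.card)) *
          Real.exp (-(θ.s2.lf.κ * torusTreeLen x.1)))
    (h130 : ∀ k v, v ∈ FlowStep.Box θ.γ k → ∀ Y φ, φ ∈ (lamF P k v).sp1 Y → ∀ a ∈ (lamF P k v).Sc Y, ∀ j ∈ Finset.range ((lamF P k v).k + 1),
      ∀ q ∈ (lamF P k v).Sq' Y a j, ∀ x ∈ (lamF P k v).SX' Y a j q,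
        ‖(lamF P k v).T' Y a j q x φ‖ ≤ K' * Real.exp (-(1 / 2) * (c.δ₀ * c.M) * (((θ.ℓ₆ + 1 : ℕ) : ℝ) ^ j * (((θ.ℓ₆ + 1 : ℕ) : ℝ) ^ (lamF P k v).k)⁻¹)⁻¹
            - (1 / 2) * c.δ₀ * dist k v Y a j q) *
          Real.exp (-(c.κ₁ - 1) * ((Y.1 \ x.1.image (tcoarse ((θ.ℓ₆ + 1) ^ ((lamF P k v).k - j)) ((θ.ℓ₆ + 1) * ((lamF P k v).n + 1)))).card : ℝ)) *
          Real.exp (-(θ.s2.lf.κ * torusTreeLen x.1)))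
    {ϑ : ℝ} (hϑ0 : 0 ≤ ϑ) (hϑ1 : ϑ < 1)
    (hC : K * K₀ 64 8 * (2 * (6 * ((θ.ℓ₆ + 1 : ℕ) : ℝ)) ^ 4) * Real.exp 1 * Real.exp ((1 / 8) * c.κ₁ * (12 ^ 4 - 1)) +
        2 * (64 * K') * K₀ 64 8 * 1344 ≤
      (1 - ϑ) * (θ.s2.lf.E₀ * c.ε₁ * c.C₁ * c.M ^ c.q * Real.exp (c.C₂ * c.κ₁)))
    -- (2) LEMMA 2 (pp. 10–11): the curvature terms and the plaquette data of every member in the box; k-UNIFORM `ϑ, R, K₂, m₂`; `g_k ≠ 0` DISCHARGED (index law)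
    (hGlAn : ∀ k v, v ∈ FlowStep.Box θ.γ k → ∀ Y, AnalyticOnNhd ℂ ((lamF P k v).Gl Y) ((lamF P k v).sp1 Y))
    (hGl : ∀ k v, v ∈ FlowStep.Box θ.γ k → ∀ Y φ, φ ∈ (lamF P k v).sp1 Y →
      ‖(lamF P k v).Gl Y φ‖ ≤ ϑ * (θ.s2.lf.E₀ * c.ε₁ * c.C₁ * c.M ^ c.q * Real.exp (c.C₂ * c.κ₁)) *
        Real.exp (-((1 - 2 * (c13OfRecord₁₂ F N θ c).δ) * θ.s2.lf.κ * (tsys 4 ((θ.ℓ₆ + 1) * ((lamF P k v).n + 1))).dj Y)))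
    (he : ∀ k v, v ∈ FlowStep.Box θ.γ k → ∀ Y b, ‖(lamF P k v).e Y b‖ ≤ 1)
    {R K₂ : ℝ} {m₂ : ℕ} (hK₂ : 0 ≤ K₂) (hR : 0 < R) (hε3 : 3 * c.ε₁ ≤ R)
    (hW : ∀ k v, v ∈ FlowStep.Box θ.γ k → ∀ Y, ∀ i ∈ (lamF P k v).s Y, ∀ φ ∈ (lamF P k v).sp1 Y, AnalyticOnNhd ℂ ((lamF P k v).Wf Y i φ) (ball 0 R))
    (hKW : ∀ k v, v ∈ FlowStep.Box θ.γ k → ∀ Y, ∀ i ∈ (lamF P k v).s Y, ∀ φ ∈ (lamF P k v).sp1 Y, ∀ z ∈ ball (0 : (lamF P k v).E) R,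
      ‖(lamF P k v).Wf Y i φ z‖ ≤ K₂ * Real.exp (-(c.κ₁ - 1) * ((Y.1.card : ℝ) - 1)) * ‖z‖ ^ 3)
    (hcard : ∀ k v, v ∈ FlowStep.Box θ.γ k → ∀ Y, ((lamF P k v).s Y).card ≤ m₂ * Y.1.card)
    (hsp : ∀ k v, v ∈ FlowStep.Box θ.γ k → ∀ Y φ, φ ∈ (lamF P k v).sp1 Y → ‖(lamF P k v).g‖ * ‖(lamF P k v).rd Y φ‖ < c.ε₁)
    (hfloor : 27 * m₂ * K₂ * Real.exp (c.κ₁ - 1) ≤ c.C₃ * c.M ^ 4 * Real.exp (c.C₂ * c.κ₁))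
    (hAnP : ∀ k v, v ∈ FlowStep.Box θ.γ k → ∀ Y, ∀ i ∈ (lamF P k v).s Y,
      AnalyticOnNhd ℂ (fun φ => scaled (lamF P k v).g ((lamF P k v).Wf Y i φ) ((lamF P k v).rd Y φ)) ((lamF P k v).sp1 Y))
    (hG : ∀ k v, v ∈ FlowStep.Box θ.γ k → ∀ Y, (lamF P k v).GaugeInv ((lamF P k v).V Y) ∧
      (lamF P k v).GaugeInv ((WtOfRecord θ.toStage3Params (lamF P k v)).toStepData.quadForm Y) ∧ (lamF P k v).GaugeInv ((lamF P k v).Vpp Y))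
    -- (3) LEMMA 3 (p. 20): THE LOCATED FLAG, member-wise, at the letters of record — NODE A's content, displayed
    (h3 : ∀ k v, v ∈ FlowStep.Box θ.γ k → B13.Lemma3Printed (WtOfRecord θ.toStage3Params (lamF P k v)).toStepData (c13OfRecord₁₂ F N θ c)) :
    B13FamLeafOfRecord₁₂ F N θ c lamF P := by
  have key : B13FamLeafOfRecord θ.toStage3Params θ.γ (lamF P) { c13OfRecord₁₂ F N θ c with L := θ.ℓ₆ + 1 } :=
    b13FamLeafOfRecord_of_located θ.toStage3Params (lamF P) (c13OfRecord₁₂ F N θ c) hc hidx hN12 dist hS0Y hFsub hSq hScY hdist0 hdist hSX hSX'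
      hX0 hAnT hAnT' hK hK' hκ (c13OfRecord₁₂_delta_lt_one F N θ c) hδκ hκ126 hκ126' hκ₁ hκ₁' hδ₀M hδ₀M5 hR8 hR9 h124 h130 hϑ0 hϑ1 hC hGlAn
      hGl he hK₂ hR hε3 hW hKW hcard hsp hfloor hAnP hG (fun k v hv => by rw [c13OfRecord₁₂_with_L]; exact h3 k v hv)
  show B13FamLeafOfRecord θ.toStage3Params θ.γ (lamF P) (c13OfRecord₁₂ F N θ c)
  rw [← c13OfRecord₁₂_with_L F N θ c]
  exact key

set_option maxSynthPendingDepth 3 in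
/-- **THE [B13] FAMILY LEAF OF RECORD AT A STAGE-12 RUN AT LEVEL T — ALL THREE LEMMAS MEMBER-WISE FROM LOCATED INPUTS, NO FLAG; LEMMA 3 AT THE NATURAL RATE WITH
ONE NUMERICS BUNDLE AT THE WINDOW OF RECORD; `δ < 1` AND `g_k ≠ 0` DISCHARGED.**  The Lemma 1–2 inputs of `b13FamLeafOfRecord₁₂_of_located` and, for LEMMA 3
(pp. 14–20) at LEVEL T (`…N10AtRecord11B13Family.b13FamLeafOfRecord_of_located_termwise` at the letters of record): for every member in the window-of-record box,
(2.26) PER TERM of the member's H(Z) (`h226` — NODE A's content in the termwise currency) AT THE NATURAL |P|-RATE `γ₂ε₁²∕g_k²` (p. 17); ONE bundle `hN` of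
print's restrictions on the constants `c13OfRecord₁₂ θ c` at ℓ = ½L at the WINDOW-MINIMAL rate `γ₂ε₁²∕γ²`, `γ = θ.γ` the coupling window OF RECORD — p. 18
LITERALLY: «Assuming (1∕20)γ₂ε₁²∕g_k² ≧ (1∕20)γ₂ε₁²∕γ² ≧ 4κ»; `0 ≤ γ₂`; the displayed bond-fineness law `(lamF P k v).m₃ = m₃`; `8 ≤ L = θ.ℓ₆ + 1` (displayed:
Stage-12 admissibility has `L` odd `> 1` only).  Termwise domination DISCHARGED (`termDomination_WtOfRecord`).  CONCLUSION: `B13FamLeafOfRecord₁₂ F N θ c lamF P`.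
Count-neutral: hypotheses about the HIDDEN family. [cite: Balaban1988RG2Cluster, Lemma 1 p.9, Lemma 2 p.11, Lemma 3 p.20, (2.26) p.17, p.18 (after (2.32)), p.21 (after (2.41)); Balaban1987RG1, Thm 3 p.264] -/
theorem b13FamLeafOfRecord₁₂_of_located_termwise
    (hc : ∀ k v, v ∈ FlowStep.Box θ.γ k → (lamF P k v).c = c13OfRecord₁₂ F N θ c) (hidx : ResidB13Fam.IsStepIndexed θ.γ (lamF P))
    (hN12 : ∀ k v, v ∈ FlowStep.Box θ.γ k → 12 ≤ (θ.ℓ₆ + 1) * ((lamF P k v).n + 1))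
    -- (1) LEMMA 1: [I]'s block geometry of the (1.33) index families of every member in the box
    (dist : (k : ℕ) → (v : Fin (k + 1) → ℝ) → TDom 4 ((θ.ℓ₆ + 1) * ((lamF P k v).n + 1)) → TPt 4 ((θ.ℓ₆ + 1) * ((lamF P k v).n + 1)) → (j : ℕ) →
      TPt 4 ((θ.ℓ₆ + 1) ^ ((lamF P k v).k - j) * ((θ.ℓ₆ + 1) * ((lamF P k v).n + 1))) → ℝ) {K K' : ℝ}
    (hS0Y : ∀ k v, v ∈ FlowStep.Box θ.γ k → ∀ Y, ∀ a ∈ (lamF P k v).S0 Y,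
      (pbox (fun i => natLift a i - (5 : ℕ)) (fun i => natLift a i + 1 + (5 : ℕ))).image (proj ((θ.ℓ₆ + 1) * ((lamF P k v).n + 1))) ⊆ Y.1)
    (hFsub : ∀ k v, v ∈ FlowStep.Box θ.γ k → ∀ Y a, (lamF P k v).F Y a ⊆
      (pbox (fun i => natLift a i - (5 : ℕ)) (fun i => natLift a i + 1 + (5 : ℕ))).image (proj ((θ.ℓ₆ + 1) * ((lamF P k v).n + 1))) \
        (pbox (fun i => natLift a i - (4 : ℕ)) (fun i => natLift a i + 1 + (4 : ℕ))).image (proj ((θ.ℓ₆ + 1) * ((lamF P k v).n + 1))))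
    (hSq : ∀ k v, v ∈ FlowStep.Box θ.γ k → ∀ Y, ∀ a ∈ (lamF P k v).S0 Y, ∀ j, (lamF P k v).Sq Y a j ⊆
      (Finset.univ : Finset (TPt 4 ((θ.ℓ₆ + 1) ^ ((lamF P k v).k - j) * ((θ.ℓ₆ + 1) * ((lamF P k v).n + 1))))).filter
        (fun q => tcoarse ((θ.ℓ₆ + 1) ^ ((lamF P k v).k - j)) ((θ.ℓ₆ + 1) * ((lamF P k v).n + 1)) q ∈
          (pbox (fun i => natLift a i - (2 : ℕ)) (fun i => natLift a i + 1 + (2 : ℕ))).image (proj ((θ.ℓ₆ + 1) * ((lamF P k v).n + 1)))))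
    (hScY : ∀ k v, v ∈ FlowStep.Box θ.γ k → ∀ Y, (lamF P k v).Sc Y ⊆ Y.1)
    (hdist0 : ∀ k v, v ∈ FlowStep.Box θ.γ k → ∀ Y a j q, 0 ≤ c.δ₀ * dist k v Y a j q)
    (hdist : ∀ k v, v ∈ FlowStep.Box θ.γ k → ∀ Y a j (n : ℕ) q,
      q ∉ (pbox (fun i => (((θ.ℓ₆ + 1) ^ ((lamF P k v).k - j) : ℕ) : ℤ) * natLift a i - (n + 1 : ℕ))
        (fun i => (((θ.ℓ₆ + 1) ^ ((lamF P k v).k - j) : ℕ) : ℤ) * natLift a i + 2 * (((θ.ℓ₆ + 1) ^ ((lamF P k v).k - j) : ℕ) : ℤ) - 1 + (n + 1 : ℕ))).image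
          (proj ((θ.ℓ₆ + 1) ^ ((lamF P k v).k - j) * ((θ.ℓ₆ + 1) * ((lamF P k v).n + 1)))) →
        c.δ₀ * c.M * ((n : ℝ) + 1) ≤ c.δ₀ * dist k v Y a j q)
    (hSX : ∀ k v, v ∈ FlowStep.Box θ.γ k → ∀ Y a j q,
      (lamF P k v).SX Y a j q ⊆ (tcubeSys 4 ((θ.ℓ₆ + 1) ^ ((lamF P k v).k - j) * ((θ.ℓ₆ + 1) * ((lamF P k v).n + 1)))).above q)
    (hSX' : ∀ k v, v ∈ FlowStep.Box θ.γ k → ∀ Y a j q,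
      (lamF P k v).SX' Y a j q ⊆ (tcubeSys 4 ((θ.ℓ₆ + 1) ^ ((lamF P k v).k - j) * ((θ.ℓ₆ + 1) * ((lamF P k v).n + 1)))).above q)
    (hX0 : ∀ k v, v ∈ FlowStep.Box θ.γ k → ∀ Y, ∀ a ∈ (lamF P k v).Sc Y, ∀ j ∈ Finset.range ((lamF P k v).k + 1), ∀ q ∈ (lamF P k v).Sq' Y a j,
      ∀ x ∈ (lamF P k v).SX' Y a j q, x.1.image (tcoarse ((θ.ℓ₆ + 1) ^ ((lamF P k v).k - j)) ((θ.ℓ₆ + 1) * ((lamF P k v).n + 1))) ⊆ Y.1)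
    -- (1) LEMMA 1: per-term analyticity on (1.34), every member in the box
    (hAnT : ∀ k v, v ∈ FlowStep.Box θ.γ k → ∀ Y, ∀ a ∈ (lamF P k v).S0 Y, ∀ X ∈ ((lamF P k v).F Y a).powerset, ∀ j ∈ Finset.range ((lamF P k v).k + 1),
      ∀ q ∈ (lamF P k v).Sq Y a j, ∀ x ∈ (lamF P k v).SX Y a j q, AnalyticOnNhd ℂ ((lamF P k v).T Y a X j q x) ((lamF P k v).sp1 Y))
    (hAnT' : ∀ k v, v ∈ FlowStep.Box θ.γ k → ∀ Y, ∀ a ∈ (lamF P k v).Sc Y, ∀ j ∈ Finset.range ((lamF P k v).k + 1), ∀ q ∈ (lamF P k v).Sq' Y a j,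
      ∀ x ∈ (lamF P k v).SX' Y a j q, AnalyticOnNhd ℂ ((lamF P k v).T' Y a j q x) ((lamF P k v).sp1 Y))
    -- (1) LEMMA 1: the k-UNIFORM thresholds READ IN θ's OWN LETTERS (κ, δ of record) and the residual letters (κ₁, δ₀, M); `δ < 1` DISCHARGED
    (hK : 0 ≤ K) (hK' : 0 ≤ K') (hκ : 0 ≤ θ.s2.lf.κ) (hδκ : 1 ≤ (c13OfRecord₁₂ F N θ c).δ * θ.s2.lf.κ)
    (hκ126 : kappa₀ 64 8 ≤ θ.s2.lf.κ) (hκ126' : kappa₀ 64 8 ≤ (c13OfRecord₁₂ F N θ c).δ * θ.s2.lf.κ)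
    (hκ₁ : 1 + 2 * Real.log (8 * 12 ^ 3) ≤ c.κ₁) (hκ₁' : 2 + 16 * Real.log 128 ≤ c.κ₁)
    (hδ₀M : 10 * Real.exp (-1) ≤ c.δ₀ * c.M) (hδ₀M5 : 2 * Real.log 5 ≤ c.δ₀ * c.M)
    (hR8 : (1 - (c13OfRecord₁₂ F N θ c).δ) * θ.s2.lf.κ ≤ (1 / 4) * (c.κ₁ - 1)) (hR9 : (1 - 2 * (c13OfRecord₁₂ F N θ c).δ) * θ.s2.lf.κ ≤ (1 / 16) * c.κ₁)
    -- (1) LEMMA 1: per-term (1.24), (1.30) by reference to [I] (3.54), (3.17), [15] Prop. 4, [13] (3.108), every member in the box; k-UNIFORM `K, K′`; the choice `hC` reads θ's `E₀`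
    (h124 : ∀ k v, v ∈ FlowStep.Box θ.γ k → ∀ Y φ, φ ∈ (lamF P k v).sp1 Y → ∀ a ∈ (lamF P k v).S0 Y, ∀ X ∈ ((lamF P k v).F Y a).powerset,
      ∀ j ∈ Finset.range ((lamF P k v).k + 1), ∀ q ∈ (lamF P k v).Sq Y a j, ∀ x ∈ (lamF P k v).SX Y a j q,
        ‖(lamF P k v).T Y a X j q x φ‖ ≤ K * (((θ.ℓ₆ + 1 : ℕ) : ℝ) ^ j * (((θ.ℓ₆ + 1 : ℕ) : ℝ) ^ (lamF P k v).k)⁻¹) ^ 5 *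
          Real.exp (-(c.κ₁ - 1) *
            (((Y.1 \ (pbox (fun i => natLift a i - (5 : ℕ)) (fun i => natLift a i + 1 + (5 : ℕ))).image
              (proj ((θ.ℓ₆ + 1) * ((lamF P k v).n + 1)))).card : ℝ) + X.card)) *
          Real.exp (-(θ.s2.lf.κ * torusTreeLen x.1)))
    (h130 : ∀ k v, v ∈ FlowStep.Box θ.γ k → ∀ Y φ, φ ∈ (lamF P k v).sp1 Y → ∀ a ∈ (lamF P k v).Sc Y, ∀ j ∈ Finset.range ((lamF P k v).k + 1),
      ∀ q ∈ (lamF P k v).Sq' Y a j, ∀ x ∈ (lamF P k v).SX' Y a j q,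
        ‖(lamF P k v).T' Y a j q x φ‖ ≤ K' * Real.exp (-(1 / 2) * (c.δ₀ * c.M) * (((θ.ℓ₆ + 1 : ℕ) : ℝ) ^ j * (((θ.ℓ₆ + 1 : ℕ) : ℝ) ^ (lamF P k v).k)⁻¹)⁻¹
            - (1 / 2) * c.δ₀ * dist k v Y a j q) *
          Real.exp (-(c.κ₁ - 1) * ((Y.1 \ x.1.image (tcoarse ((θ.ℓ₆ + 1) ^ ((lamF P k v).k - j)) ((θ.ℓ₆ + 1) * ((lamF P k v).n + 1)))).card : ℝ)) *
          Real.exp (-(θ.s2.lf.κ * torusTreeLen x.1)))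
    {ϑ : ℝ} (hϑ0 : 0 ≤ ϑ) (hϑ1 : ϑ < 1)
    (hC : K * K₀ 64 8 * (2 * (6 * ((θ.ℓ₆ + 1 : ℕ) : ℝ)) ^ 4) * Real.exp 1 * Real.exp ((1 / 8) * c.κ₁ * (12 ^ 4 - 1)) +
        2 * (64 * K') * K₀ 64 8 * 1344 ≤
      (1 - ϑ) * (θ.s2.lf.E₀ * c.ε₁ * c.C₁ * c.M ^ c.q * Real.exp (c.C₂ * c.κ₁)))
    -- (2) LEMMA 2 (pp. 10–11): the curvature terms and the plaquette data of every member in the box; k-UNIFORM `ϑ, R, K₂, m₂`; `g_k ≠ 0` DISCHARGED (index law)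
    (hGlAn : ∀ k v, v ∈ FlowStep.Box θ.γ k → ∀ Y, AnalyticOnNhd ℂ ((lamF P k v).Gl Y) ((lamF P k v).sp1 Y))
    (hGl : ∀ k v, v ∈ FlowStep.Box θ.γ k → ∀ Y φ, φ ∈ (lamF P k v).sp1 Y →
      ‖(lamF P k v).Gl Y φ‖ ≤ ϑ * (θ.s2.lf.E₀ * c.ε₁ * c.C₁ * c.M ^ c.q * Real.exp (c.C₂ * c.κ₁)) *
        Real.exp (-((1 - 2 * (c13OfRecord₁₂ F N θ c).δ) * θ.s2.lf.κ * (tsys 4 ((θ.ℓ₆ + 1) * ((lamF P k v).n + 1))).dj Y)))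
    (he : ∀ k v, v ∈ FlowStep.Box θ.γ k → ∀ Y b, ‖(lamF P k v).e Y b‖ ≤ 1)
    {R K₂ : ℝ} {m₂ : ℕ} (hK₂ : 0 ≤ K₂) (hR : 0 < R) (hε3 : 3 * c.ε₁ ≤ R)
    (hW : ∀ k v, v ∈ FlowStep.Box θ.γ k → ∀ Y, ∀ i ∈ (lamF P k v).s Y, ∀ φ ∈ (lamF P k v).sp1 Y, AnalyticOnNhd ℂ ((lamF P k v).Wf Y i φ) (ball 0 R))
    (hKW : ∀ k v, v ∈ FlowStep.Box θ.γ k → ∀ Y, ∀ i ∈ (lamF P k v).s Y, ∀ φ ∈ (lamF P k v).sp1 Y, ∀ z ∈ ball (0 : (lamF P k v).E) R,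
      ‖(lamF P k v).Wf Y i φ z‖ ≤ K₂ * Real.exp (-(c.κ₁ - 1) * ((Y.1.card : ℝ) - 1)) * ‖z‖ ^ 3)
    (hcard : ∀ k v, v ∈ FlowStep.Box θ.γ k → ∀ Y, ((lamF P k v).s Y).card ≤ m₂ * Y.1.card)
    (hsp : ∀ k v, v ∈ FlowStep.Box θ.γ k → ∀ Y φ, φ ∈ (lamF P k v).sp1 Y → ‖(lamF P k v).g‖ * ‖(lamF P k v).rd Y φ‖ < c.ε₁)
    (hfloor : 27 * m₂ * K₂ * Real.exp (c.κ₁ - 1) ≤ c.C₃ * c.M ^ 4 * Real.exp (c.C₂ * c.κ₁))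
    (hAnP : ∀ k v, v ∈ FlowStep.Box θ.γ k → ∀ Y, ∀ i ∈ (lamF P k v).s Y,
      AnalyticOnNhd ℂ (fun φ => scaled (lamF P k v).g ((lamF P k v).Wf Y i φ) ((lamF P k v).rd Y φ)) ((lamF P k v).sp1 Y))
    (hG : ∀ k v, v ∈ FlowStep.Box θ.γ k → ∀ Y, (lamF P k v).GaugeInv ((lamF P k v).V Y) ∧
      (lamF P k v).GaugeInv ((WtOfRecord θ.toStage3Params (lamF P k v)).toStepData.quadForm Y) ∧ (lamF P k v).GaugeInv ((lamF P k v).Vpp Y))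
    -- (3) LEMMA 3 (pp. 14–20) at LEVEL T: (2.26) per term per member at the natural rate; ONE numerics bundle at the window-minimal rate (p. 18); the fineness law; 8 ≤ L
    (hL8 : 8 ≤ θ.ℓ₆ + 1) (hγ₂ : 0 ≤ c.γ₂) {m₃ : ℕ} (hm₃ : ∀ k v, v ∈ FlowStep.Box θ.γ k → (lamF P k v).m₃ = m₃) {a₂ a₂' a₅ Aabs : ℝ}
    (h226 : ∀ k v, v ∈ FlowStep.Box θ.γ k →
      Termwise226 (c13OfRecord₁₂ F N θ c) (c.γ₂ * c.ε₁ ^ 2 / (v (Fin.last k)) ^ 2) a₅ (WtOfRecord θ.toStage3Params (lamF P k v)) (lamF P k v).T₃)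
    (hN : Lemma3Numerics (c13OfRecord₁₂ F N θ c) (m₃ + 1) (((θ.ℓ₆ + 1 : ℕ) : ℝ) / 2) (c.γ₂ * c.ε₁ ^ 2 / θ.γ ^ 2) a₂ a₂' a₅ Aabs) :
    B13FamLeafOfRecord₁₂ F N θ c lamF P := by
  have key : B13FamLeafOfRecord θ.toStage3Params θ.γ (lamF P) { c13OfRecord₁₂ F N θ c with L := θ.ℓ₆ + 1 } :=
    b13FamLeafOfRecord_of_located_termwise θ.toStage3Params (lamF P) (c13OfRecord₁₂ F N θ c) hc hidx hN12 dist hS0Y hFsub hSq hScY hdist0 hdist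
      hSX hSX' hX0 hAnT hAnT' hK hK' hκ (c13OfRecord₁₂_delta_lt_one F N θ c) hδκ hκ126 hκ126' hκ₁ hκ₁' hδ₀M hδ₀M5 hR8 hR9 h124 h130 hϑ0 hϑ1 hC
      hGlAn hGl he hK₂ hR hε3 hW hKW hcard hsp hfloor hAnP hG hL8 hγ₂ hm₃ (fun k v hv => by rw [c13OfRecord₁₂_with_L]; exact h226 k v hv)
      (by rw [c13OfRecord₁₂_with_L]; exact hN)
  show B13FamLeafOfRecord θ.toStage3Params θ.γ (lamF P) (c13OfRecord₁₂ F N θ c)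
  rw [← c13OfRecord₁₂_with_L F N θ c]
  exact key

end Letters12

/-! ## §2. The DAG pin at a box member, and the K1′-facing ∃-face, in the family currency -/

section Pin

variable (F : T4Family) (N : ℕ) [NeZero N]
variable (θ : Stage12Params F N) (c : B13.Consts) (lamF : ResidB13Fam₁₂ F N θ)

/-- **N10 AT A RUN BOUND TO def-B13's [B13] PIN AT A BOX MEMBER OF THE FAMILY, FROM THE FAMILY LEAF OF RECORD.**  The DAG slot `PrintedCarriersR.S13` is ONE step
datum per run; given the family leaf of record at the run `P`, a member `(k, v)` in the window-of-record box with the letters of record, and ANY per-run instance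
layer `lam13` that AT `P` is that member (`hsel`), the world bound to the C-binding of the [B13]-pinned Stage-12 view `(θ.pinB13 lam13).toStage5₁₂` has
`Dag.B13_main` at `P` — def-B13's member bridge `b13LeafOfRecord_member₁₂` + `…N10AtRecord12B13.b13_main_at_pinB13₁₂_of_leafOfRecord`.  Which member is «the» run's
[B13] datum is the consumer's selection (print: every `k ≤ K` along the run's own history).  Count-neutral. [cite: Balaban1988RG2Cluster, Lemmas 1–3 pp.9, 11, 20; Balaban1987RG1, Thm 3 p.264 (one family, every step)] -/
theorem b13_main_at_pinB13₁₂_of_famLeafOfRecord {P : B12.RunParams} (hleaf : B13FamLeafOfRecord₁₂ F N θ c lamF P) {k : ℕ} {v : Fin (k + 1) → ℝ}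
    (hv : v ∈ FlowStep.Box θ.γ k) (hc : (lamF P k v).c = c13OfRecord₁₂ F N θ c) (lam13 : B12.RunParams → ResidB13 θ.toStage3Params)
    (hsel : lam13 P = lamF P k v) (w : WorldP) (hup : w.up P = upOfRecord₅C F N ((θ.pinB13 F N lam13).toStage5₁₂ F N) P) :
    Dag.B13_main (leavesP w P) := by
  refine b13_main_at_pinB13₁₂_of_leafOfRecord F N θ lam13 w P hup ?_
  rw [hsel]
  exact b13LeafOfRecord_member₁₂ hleaf hv hc

/-- **K1′-FACING ∃-FACE IN THE FAMILY CURRENCY: for any admissible Stage-12 package `θ` with provisos, any Stage-12 [B13] family carrying the family leaf of record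
at EVERY run, and any per-run SELECTION of a box member with the letters of record (`κ P, ν P` — displayed; e.g. a step of the run at its own coupling prefix), the
world bound at the C-binding of the view [B13]-PINNED AT THE SELECTED MEMBERS is a ₁₂C record OF θ's OWN DATUM with `Dag.B13_main` at every run** (any window
`γw ∈ ]0, θ.γ]`, block size `θ.L`; the pin is UP-SIDE) — `…N10AtRecord12B13.exists_record₁₂C_pinB13World_b13_main_of_leafOfRecord` at `lam13 P := lamF P (κ P) (ν P)`
with def-B13's member bridge.  HONESTY as there: in the ∃-currency this conjunct is junk-dischargeable (the ZERO family); content = the term tower OF RECORD or §1's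
∀-lawful inputs as THEOREMS about it.  Count-neutral; nothing of Bałaban's asserted. [cite: Balaban1988RG2Cluster, Lemmas 1–3 pp.9, 11, 20; Balaban1989LargeFieldII, Thm 1 + (0.1) pp.355–356 (the record)] -/
theorem exists_record₁₂C_pinB13World_b13_main_of_famLeafOfRecord (h : θ.Provisos₁₂ F N) (hθ : θ.Admissible F N) {γw : ℝ} (hγw : 0 < γw ∧ γw ≤ θ.γ)
    (hleaf : ∀ P, B13FamLeafOfRecord₁₂ F N θ c lamF P) (κ : B12.RunParams → ℕ) (ν : (P : B12.RunParams) → Fin (κ P + 1) → ℝ)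
    (hν : ∀ P, ν P ∈ FlowStep.Box θ.γ (κ P)) (hc : ∀ P, (lamF P (κ P) (ν P)).c = c13OfRecord₁₂ F N θ c) :
    ∃ w : WorldP, IsRecordOfRecord₁₂C F N (datumOfRecord₁₂ F N θ h) w ∧ w.γ = γw ∧ w.L = (θ.L : ℝ) ∧
      (∀ P, w.up P = upOfRecord₅C F N ((θ.pinB13 F N fun P => lamF P (κ P) (ν P)).toStage5₁₂ F N) P) ∧
        ∀ P : B12.RunParams, Dag.B13_main (leavesP w P) :=
  exists_record₁₂C_pinB13World_b13_main_of_leafOfRecord F N θ h hθ (fun P => lamF P (κ P) (ν P)) hγw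
    fun P => b13LeafOfRecord_member₁₂ (hleaf P) (hν P) (hc P)

end Pin

/-! ## §3. LOCATED: the (I.1.18)-rate demand of the junction at the letters of record, in numbers (FLAG-K0′-KAPPA, N10's side) -/

section Located

variable (F : T4Family) (N : ℕ) [NeZero N] (θ : Stage12Params F N) (c : B13.Consts)

/-- The tree's threshold constant of (1.26) read as a number: `κ₀(64, 8) = 64·log 162` (`a₀ 8 = log(2·9²)`). [cite: Balaban1988RG2Cluster, (1.26) p.8 (the threshold «κ sufficiently large»; bookkeeping)] -/
theorem kappa₀_64_8 : kappa₀ 64 8 = 64 * Real.log 162 := by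
  norm_num [kappa₀, a₀]

/-- **LOCATED (N10's side of FLAG-K0′-KAPPA)**: §1's threshold `hκ126 : κ₀(64, 8) ≤ κ` at the letters of record demands θ's (I.1.18) rate `θ.s2.lf.κ ≥ 64·log 162`
(≈ 325.6). [cite: Balaban1988RG2Cluster, (1.26) p.8, p.21 (after (2.41)); Balaban1987RG1, (1.18) p.263 («κ sufficiently large»)] -/
theorem kappa_ge_of_threshold126 (h : kappa₀ 64 8 ≤ θ.s2.lf.κ) : 64 * Real.log 162 ≤ θ.s2.lf.κ := kappa₀_64_8 ▸ h

/-- **LOCATED**: §1's threshold `hκ126' : κ₀(64, 8) ≤ δκ` at the record's `δ = (1 − 2∕L)∕10 < 1∕10` demands `θ.s2.lf.κ ≥ 640·log 162` (≈ 3256) when `0 ≤ κ`.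
[cite: Balaban1988RG2Cluster, (1.26) p.8, p.21 (after (2.41): δ = (1∕10)(1 − 2L⁻¹))] -/
theorem kappa_ge_of_threshold126' (hκ : 0 ≤ θ.s2.lf.κ) (h : kappa₀ 64 8 ≤ (c13OfRecord₁₂ F N θ c).δ * θ.s2.lf.κ) :
    640 * Real.log 162 ≤ θ.s2.lf.κ := by
  have hδ := c13OfRecord₁₂_delta_bounds F N θ c
  have h1 : (c13OfRecord₁₂ F N θ c).δ * θ.s2.lf.κ ≤ (1 / 10) * θ.s2.lf.κ := mul_le_mul_of_nonneg_right hδ.2.le hκ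
  rw [kappa₀_64_8] at h
  linarith

/-- **LOCATED VACUITY AT SMALL κ**: at any Stage-12 package whose (I.1.18) rate is `≤ 10` — in particular at NODE 00's displayed default letters
(`Node00.Record12Numerics.lfConstsOfRecord₁₂`, `κ := 1`, carried by K0′'s witness by `rfl`; dag-lead FLAG-K0′-KAPPA, TABLE v32 § K0′ row P13) — §1's threshold
`hδκ : 1 ≤ δκ` FAILS (the record's `δ < 1∕10`), so §1 is VACUOUS there: a located numeric demand on the witness's κ, NOT a refutation of anything of Bałaban's
(print's κ IS large); §1 is never stated «at θ₀». [cite: Balaban1988RG2Cluster, p.21 (after (2.41)); Balaban1987RG1, (1.18) p.263] -/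
theorem not_threshold_δκ_of_kappa_le_ten (h : θ.s2.lf.κ ≤ 10) : ¬ 1 ≤ (c13OfRecord₁₂ F N θ c).δ * θ.s2.lf.κ := by
  intro h1
  have hδ := c13OfRecord₁₂_delta_bounds F N θ c
  have h2 : (c13OfRecord₁₂ F N θ c).δ * θ.s2.lf.κ ≤ (c13OfRecord₁₂ F N θ c).δ * 10 := mul_le_mul_of_nonneg_left h hδ.1.le
  linarith

/-- **LOCATED VACUITY AT κ = 1** (NODE 00's displayed default): §1's threshold `hκ126 : κ₀(64, 8) ≤ κ` FAILS at `θ.s2.lf.κ = 1` (`64·log 162 > 64`).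
[cite: Balaban1988RG2Cluster, (1.26) p.8; Balaban1987RG1, (1.18) p.263] -/
theorem not_threshold126_of_kappa_eq_one (h : θ.s2.lf.κ = 1) : ¬ kappa₀ 64 8 ≤ θ.s2.lf.κ := by
  intro h'
  rw [kappa₀_64_8, h] at h'
  have hlog : 1 < Real.log 162 := by
    rw [Real.lt_log_iff_exp_lt (by norm_num)]
    exact Real.exp_one_lt_d9.trans (by norm_num)
  linarith

/-! ### §3b (v1.1, append-only). The SUFFICIENT side: a κ the witness may carry for N10's Lemma 1–2 thresholds at the letters of record -/

/-- The record's `δ = (1 − 2∕L)∕10` is at least `1∕30` (`L = ℓ₆ + 1 ≥ 3`). [cite: Balaban1988RG2Cluster, p.21 (after (2.41): δ = (1∕10)(1 − 2L⁻¹)); Balaban1987RG1, p.253 (L odd; bookkeeping)] -/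
theorem one_div_thirty_le_delta : 1 / 30 ≤ (c13OfRecord₁₂ F N θ c).δ := by
  have hL : (3 : ℝ) ≤ (θ.ℓ₆ : ℝ) + 1 := by exact_mod_cast three_le_ell6_succ F N θ
  have h23 : 2 / ((θ.ℓ₆ : ℝ) + 1) ≤ 2 / 3 := div_le_div_of_nonneg_left (by norm_num) (by norm_num) hL
  rw [c13OfRecord₁₂_δ]
  linarith

/-- The tree's (1.26) threshold constant is at most `384` (`log 162 ≤ 6` from `e > 2.718`). [cite: Balaban1988RG2Cluster, (1.26) p.8 (bookkeeping numeral)] -/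
theorem kappa₀_64_8_le_384 : kappa₀ 64 8 ≤ 384 := by
  rw [kappa₀_64_8]
  have hlog : Real.log 162 ≤ 6 := by
    rw [Real.log_le_iff_le_exp (by norm_num)]
    calc (162 : ℝ) ≤ 2.7182818283 ^ 6 := by norm_num
      _ ≤ Real.exp 1 ^ 6 := pow_le_pow_left₀ (by norm_num) Real.exp_one_gt_d9.le 6
      _ = Real.exp 6 := by rw [← Real.exp_nat_mul]; norm_num
  linarith

/-- **SUFFICIENT κ — N10's Lemma 1–2 side of dag-lead's § K0′ row P13, a kernel certificate**: at ANY Stage-12 package whose (I.1.18) rate satisfies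
`2·10⁴ ≤ θ.s2.lf.κ`, and for any residual letters with `κ₁ ≥ 16κ + 1`, EVERY k-uniform Lemma-1 threshold of §1 that reads θ's rate HOLDS at the record's δ, for every
`L ≥ 3` (`1∕30 ≤ δ < 1∕10`): `0 ≤ κ`, `1 ≤ δκ`, `κ₀(64,8) ≤ κ`, `κ₀(64,8) ≤ δκ`, R8 `(1 − δ)κ ≤ ¼(κ₁ − 1)`, R9 `(1 − 2δ)κ ≤ κ₁∕16`.  So a K0′ witness re-pinned with
`s2.lf.κ := 2·10⁴` (necessary: `≥ 640·log 162 ≈ 3256`, §3) makes §1's rate thresholds non-vacuous at the letters of record; the remaining located inputs (per-term data,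
`hC` on `E₀`, the Lemma-3 side) are untouched by this.  A located numeric reading of print's «κ sufficiently large» ([II] p.21 L9), NOT an estimate of Bałaban's.
[cite: Balaban1988RG2Cluster, (1.26) p.8, p.9 (R7–R9 before Lemma 1), p.21 (after (2.41)); Balaban1987RG1, (1.18) p.263] -/
theorem thresholds_of_kappa_ge (hκ : 2 * 10 ^ 4 ≤ θ.s2.lf.κ) (hκ₁ : 16 * θ.s2.lf.κ + 1 ≤ c.κ₁) :
    0 ≤ θ.s2.lf.κ ∧ 1 ≤ (c13OfRecord₁₂ F N θ c).δ * θ.s2.lf.κ ∧ kappa₀ 64 8 ≤ θ.s2.lf.κ ∧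
      kappa₀ 64 8 ≤ (c13OfRecord₁₂ F N θ c).δ * θ.s2.lf.κ ∧
      (1 - (c13OfRecord₁₂ F N θ c).δ) * θ.s2.lf.κ ≤ (1 / 4) * (c.κ₁ - 1) ∧ (1 - 2 * (c13OfRecord₁₂ F N θ c).δ) * θ.s2.lf.κ ≤ (1 / 16) * c.κ₁ := by
  have hδ := c13OfRecord₁₂_delta_bounds F N θ c
  have hδlo := one_div_thirty_le_delta F N θ c
  have hk := kappa₀_64_8_le_384
  have hκ0 : 0 ≤ θ.s2.lf.κ := by linarith
  have hδκ : (1 / 30) * θ.s2.lf.κ ≤ (c13OfRecord₁₂ F N θ c).δ * θ.s2.lf.κ := mul_le_mul_of_nonneg_right hδlo hκ0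
  have h1δ : (1 - (c13OfRecord₁₂ F N θ c).δ) * θ.s2.lf.κ ≤ θ.s2.lf.κ := by nlinarith [hδ.1]
  have h2δ : (1 - 2 * (c13OfRecord₁₂ F N θ c).δ) * θ.s2.lf.κ ≤ θ.s2.lf.κ := by nlinarith [hδ.1]
  exact ⟨hκ0, by linarith, by linarith, by linarith, by linarith, by linarith⟩

end Located

end Summit.QuantumFields.YangMills.BalabanUVNodes.N10AtRecord12B13Family

end
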